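import Literature.NumberTheory.EllipticCurves.KubertTateFiveEisensteinTwist
import Literature.NumberTheory.EllipticCurves.KubertTate373ShaFive
import Literature.NumberTheory.EllipticCurves.LocalReductionKrausMinimality
import Literature.NumberTheory.EllipticCurves.ComplexMultiplicationLocalFactorsAux
import Literature.NumberTheory.EllipticCurves.OrdinaryPrimesProofs
import Literature.NumberTheory.EllipticCurves.QuadraticTwistSelmerPInfty
import Literature.NumberTheory.EllipticCurves.RationalPointInfiniteOrderCriteria
import Literature.NumberTheory.EllipticCurves.Rank1Residual.GVParityTwistProofs
import Literature.NumberTheory.EllipticCurves.MazurTorsionGaloisStructureProofs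
import Mathlib.Tactic.NormNum.Prime
import HarnessLib

/-!
# The Eisenstein twist `E_{37/3}^{(-3)}`: RANK `1`, `t₅ = 0` unconditionally, and its minimal model
# `[0, −540, −11, 53097, −852573]` — a NON-anomalous Eisenstein prime `5` (`a₅ = −1`) with `corank_{ℤ₅} Sel_{5^∞} = 1`

PROOF-ONLY file (theorems only, no definition, no named fact, no `sorry`), topic `NumberTheory/EllipticCurves`; the rank-`1` row of the
Eisenstein-twist table, by the CHEAP route of the class-wide criterion `KubertTateEisensteinTwist.twist_door_of_le_rank_three` (Eisenstein-tame
`E_{m,n}`, full `ℚ`-box, `rank E^{(-3)}(ℚ) ≥ ω₂(mn)` ⟹ `t₅(E^{(-3)}) = 0`, `rank E^{(-3)} = ω₂(mn)`): only ONE point of infinite order on the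
twist over `ℚ` is needed, no `ℤ[ζ₃]`-valuation table.

`E = E_{37/3} = [-34, -111, -333, 0, 0]` (tree `KubertTate373Descent`: rank `1`, box full; `Δ = 3⁵·37⁵·139`, Eisenstein-tame — tree
`KubertTateVelu.eisenstein_tame_37_3`; `mn = 111 = 3·37`, `ω₂ = 1` since `37 ≡ 1 (mod 3)`).  The twist `quadraticTwist (-3) =
[0, −534, 0, 50949, −2994003/4]` is `ℚ`-isomorphic (`⟨1, 2, 0, 11/2⟩ • W = …`) to the integer model **`W = [0, −540, −11, 53097, −852573]`**,
globally minimal (`Δ_W = 3¹¹·37⁵·139`, no `q¹² ∣ Δ`), carrying the rational points `P = (7025/16, 111241/64)` (from the twist point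
`(u, Y) = (-2331/16, 12321/64)`, `-3·4Y² = g(u)`) and `3P = (6044282033/8737936, 269160182481961/25829338816)` with `739 ∣ den x(3P)`, so `3P` has
infinite order (Lutz–Nagell at the odd prime `739`) and `rank W(ℚ) ≥ 1 = ω₂`.  Hence:

* `twist_37_3` — **`rank E_{37/3}^{(-3)}(ℚ) = 1`, `t₅(E_{37/3}^{(-3)}/ℚ) = 0`, `t₅(E_{37/3}/ℚ) = 0`** (descent over `ℚ(ζ₃)`, no `L`-function);
* `#W̃(𝔽₅) = 7`, **`a₅(W) = −1`**: `Good W 5`, `Red W 5` (twist of a curve with rational `5`-torsion), **`¬ Anom W 5`** — `(W, 5)` is a NON-anomalous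
  Eisenstein pair (`5` inert in `ℚ(√-3)`), inside the printed scope of Castella–Grossi–Lee–Skinner's Theorem E;
* `mordellWeilRank_model = 1`, **`selmerCorank_model_five : corank_{ℤ₅} Sel_{5^∞}(W/ℚ) = 1`** — EXACTLY the hypothesis of Theorem E (`r = 1`),
  certified by descent alone.

Transfer statement T (stmt-BirchSwinnertonDyer-22356) instrument; the Summits reading feeds this to CGLS Thm. E + GZK (refereed named facts), after
which `ord_{s=1} L(W,s) = 1`, `Ш(W/ℚ)` is finite and T holds AT THIS RANK-ONE CURVE.  BSD is not proved by this.

## References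

* [SilvermanAEC2009] J. H. Silverman, *AEC*, 2nd ed., III.1 Table 3.1, VII.1 Remark 1.1, VII.3.4, VIII.6.7, X.§2, Exercise 10.16.
* [Fisher2001FiveSevenDescent] T. Fisher, JEMS 3 (2001), §§1–2.
* [CastellaGrossiLeeSkinner2022] F. Castella, G. Grossi, J. Lee, C. Skinner, Invent. Math. 227 (2022), Thm. E.
* [Mazur1977] B. Mazur, *Modular curves and the Eisenstein ideal*, Ch. III §5.
-/

noncomputable section

open scoped Classical
open WeierstrassCurve Literature.NumberTheory.EllipticCurves
open Literature.NumberTheory.EllipticCurves.Rank1Residual.X11RankOneCertificates (discOf c4Of c6Of)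
open Literature.NumberTheory.EllipticCurves.Rank1Residual

namespace Literature.NumberTheory.EllipticCurves

namespace KubertTate373EisensteinTwist

/-! ## §1 The twist and its minimal model `W = [0, −540, −11, 53097, −852573]` -/

/-- The twist by `-3` is elliptic (`-3 ≠ 0`). [cite: SilvermanAEC2009, X.§2] -/
theorem isElliptic_twist :
    haveI := KubertTate373Descent.isElliptic
    ((kubertTateFive (((37 : ℤ) : ℚ)) (((3 : ℤ) : ℚ))).quadraticTwist (-3)).IsElliptic := by
  haveI := KubertTate373Descent.isElliptic
  exact isElliptic_quadraticTwist _ (by norm_num)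

/-- **`E_{37/3}^{(-3)} = [0, −534, 0, 50949, −2994003/4]`** (`b₂ = 712`, `b₄ = 11322`, `b₆ = 110889`; NOT an integral model).
[cite: SilvermanAEC2009, X.§2] -/
theorem twist_eq : (kubertTateFive (((37 : ℤ) : ℚ)) (((3 : ℤ) : ℚ))).quadraticTwist (-3) =
    (⟨0, -534, 0, 50949, -2994003 / 4⟩ : WeierstrassCurve ℚ) := by
  rw [KubertTate373Descent.curve_eq]
  ext <;> simp [quadraticTwist, WeierstrassCurve.b₂, WeierstrassCurve.b₄, WeierstrassCurve.b₆] <;> norm_num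

/-- **The integer model `W = [0, −540, −11, 53097, −852573]` is `ℚ`-isomorphic to the twist**: `⟨1, 2, 0, 11/2⟩ • W = E_{37/3}^{(-3)}`
(`x = x' + 2`, `y = y' + 11/2`). [cite: SilvermanAEC2009, III.1 Table 3.1] -/
theorem variableChange_model :
    (⟨1, 2, 0, 11 / 2⟩ : VariableChange ℚ) •
        (⟨((0 : ℤ) : ℚ), ((-540 : ℤ) : ℚ), ((-11 : ℤ) : ℚ), ((53097 : ℤ) : ℚ), ((-852573 : ℤ) : ℚ)⟩ : WeierstrassCurve ℚ) =
      (kubertTateFive (((37 : ℤ) : ℚ)) (((3 : ℤ) : ℚ))).quadraticTwist (-3) := by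
  rw [twist_eq]
  ext <;> simp [variableChange_a₁, variableChange_a₂, variableChange_a₃, variableChange_a₄, variableChange_a₆] <;> norm_num

/-- The model `W` is elliptic. [cite: SilvermanAEC2009, X.§2] -/
theorem isElliptic_model :
    (⟨((0 : ℤ) : ℚ), ((-540 : ℤ) : ℚ), ((-11 : ℤ) : ℚ), ((53097 : ℤ) : ℚ), ((-852573 : ℤ) : ℚ)⟩ : WeierstrassCurve ℚ).IsElliptic := by
  refine ⟨isUnit_iff_ne_zero.mpr ?_⟩
  norm_num [WeierstrassCurve.Δ, WeierstrassCurve.b₂, WeierstrassCurve.b₄, WeierstrassCurve.b₆, WeierstrassCurve.b₈]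

/-- `Δ`, `c₄`, `c₆` of the integer model (kernel evaluation). [folklore] -/
private theorem invariants_model :
    discOf [0, -540, -11, 53097, -852573] = 1707486279144381 ∧
    c4Of [0, -540, -11, 53097, -852573] = 2116944 ∧
    c6Of [0, -540, -11, 53097, -852573] = 2556647496 := by
  refine ⟨?_, ?_, ?_⟩ <;> decide

/-- **`W` is globally minimal**: `Δ_W = 1707486279144381 = 3¹¹·37⁵·139` is not divisible by any `q¹²` (at `3` the twist of the multiplicative
fibre is additive `I₅*`, `v₃(Δ) = 11`). [cite: SilvermanAEC2009, VII.1 Remark 1.1] -/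
theorem isGloballyMinimal_model :
    (⟨((0 : ℤ) : ℚ), ((-540 : ℤ) : ℚ), ((-11 : ℤ) : ℚ), ((53097 : ℤ) : ℚ), ((-852573 : ℤ) : ℚ)⟩ :
      WeierstrassCurve ℚ).IsGloballyMinimal := by
  obtain ⟨hD, -, -⟩ := invariants_model
  refine WeierstrassCurve.isGloballyMinimal_of_int_kraus 0 (-540) (-11) 53097 (-852573) fun q hq ↦ Or.inl fun h ↦ ?_
  obtain ⟨h12, -⟩ := h
  rw [hD] at h12
  have hq1 : (q : ℤ) ∣ 1707486279144381 := dvd_trans (dvd_pow_self _ (by norm_num)) h12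
  have hdvdN : q ∣ 3 ^ 11 * 37 ^ 5 * 139 := by
    have e : ((3 ^ 11 * 37 ^ 5 * 139 : ℕ) : ℤ) = 1707486279144381 := by norm_num
    exact Int.natCast_dvd_natCast.mp (e ▸ hq1)
  have hpi := Nat.Prime.prime hq
  rcases hpi.dvd_or_dvd hdvdN with h | h
  · rcases hpi.dvd_or_dvd h with h | h
    · have := (Nat.prime_dvd_prime_iff_eq hq Nat.prime_three).mp (hpi.dvd_of_dvd_pow h)
      subst this; revert h12; norm_num
    · have := (Nat.prime_dvd_prime_iff_eq hq (by norm_num : Nat.Prime 37)).mp (hpi.dvd_of_dvd_pow h)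
      subst this; revert h12; norm_num
  · have := (Nat.prime_dvd_prime_iff_eq hq (by norm_num : Nat.Prime 139)).mp h
    subst this; revert h12; norm_num

/-- The tree's integral model of `W` is the integer equation. [cite: SilvermanAEC2009, VIII.8] -/
theorem integralModelInt_model :
    haveI := isGloballyMinimal_model
    integralModelInt (⟨((0 : ℤ) : ℚ), ((-540 : ℤ) : ℚ), ((-11 : ℤ) : ℚ), ((53097 : ℤ) : ℚ), ((-852573 : ℤ) : ℚ)⟩ : WeierstrassCurve ℚ) =
      ⟨0, -540, -11, 53097, -852573⟩ := by
  haveI := isGloballyMinimal_model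
  apply WeierstrassCurve.map_injective (f := Int.castRingHom ℚ) Int.cast_injective
  beta_reduce
  rw [map_integralModelInt]
  ext <;> simp [WeierstrassCurve.map]

/-! ## §2 The rational points `P` and `3P` of `W`; `rank W(ℚ) ≥ 1` -/

/-- **The rational point `P = (7025/16, 111241/64)` of `W`** (the twist point `(u, Y) = (-2331/16, 12321/64)` of `E_{37/3}`, moved to `W`).
[cite: SilvermanAEC2009, X.§2] -/
theorem nonsingular_P :
    (⟨((0 : ℤ) : ℚ), ((-540 : ℤ) : ℚ), ((-11 : ℤ) : ℚ), ((53097 : ℤ) : ℚ), ((-852573 : ℤ) : ℚ)⟩ : WeierstrassCurve ℚ).toAffine.Nonsingular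
      (7025 / 16) (111241 / 64) := by
  haveI := isElliptic_model
  rw [← Affine.equation_iff_nonsingular, Affine.equation_iff]
  push_cast
  norm_num

/-- **The rational point `3P = (6044282033/8737936, 269160182481961/25829338816)` of `W`** (`den x(3P) = 2⁴·739²`).
[cite: SilvermanAEC2009, III.2.3] -/
theorem nonsingular_threeP :
    (⟨((0 : ℤ) : ℚ), ((-540 : ℤ) : ℚ), ((-11 : ℤ) : ℚ), ((53097 : ℤ) : ℚ), ((-852573 : ℤ) : ℚ)⟩ : WeierstrassCurve ℚ).toAffine.Nonsingular
      (6044282033 / 8737936) (269160182481961 / 25829338816) := by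
  haveI := isElliptic_model
  rw [← Affine.equation_iff_nonsingular, Affine.equation_iff]
  push_cast
  norm_num

/-- **`rank W(ℚ) ≥ 1`**: the rational point `3P` has `739 ∣ den x(3P)`, so it has infinite order (Lutz–Nagell / AEC VII.3.4 at the odd prime
`739` on the globally minimal model; tree `one_le_mordellWeilRank_of_dvd_den`) and Mordell–Weil gives `rank ≥ 1`.
[cite: SilvermanAEC2009, VII.3.4 and Thm. VIII.6.7] -/
theorem one_le_mordellWeilRank_model :
    haveI := isElliptic_model
    1 ≤ (⟨((0 : ℤ) : ℚ), ((-540 : ℤ) : ℚ), ((-11 : ℤ) : ℚ), ((53097 : ℤ) : ℚ), ((-852573 : ℤ) : ℚ)⟩ : WeierstrassCurve ℚ).mordellWeilRank := by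
  haveI := isElliptic_model
  haveI := isGloballyMinimal_model
  haveI : Fact (Nat.Prime 739) := ⟨by norm_num⟩
  exact one_le_mordellWeilRank_of_dvd_den _ 739 (by norm_num) nonsingular_threeP (by norm_num)

/-- Transport of the Mordell–Weil rank along an equality of curves. [folklore] -/
private theorem mordellWeilRank_congr {V V' : WeierstrassCurve ℚ} [V.IsElliptic] [V'.IsElliptic] (e : V = V') :
    V.mordellWeilRank = V'.mordellWeilRank := by
  subst e; rfl

/-- **`rank W(ℚ) = rank E_{37/3}^{(-3)}(ℚ)`** (isomorphic curves; tree `mordellWeilRank_variableChange_holds`). [cite: SilvermanAEC2009, VIII.§1] -/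
theorem mordellWeilRank_model_eq_twist :
    haveI := isElliptic_model
    haveI := isElliptic_twist
    (⟨((0 : ℤ) : ℚ), ((-540 : ℤ) : ℚ), ((-11 : ℤ) : ℚ), ((53097 : ℤ) : ℚ), ((-852573 : ℤ) : ℚ)⟩ : WeierstrassCurve ℚ).mordellWeilRank =
      ((kubertTateFive (((37 : ℤ) : ℚ)) (((3 : ℤ) : ℚ))).quadraticTwist (-3)).mordellWeilRank := by
  haveI := isElliptic_model
  haveI := isElliptic_twist
  rw [← mordellWeilRank_variableChange_holds
    (⟨((0 : ℤ) : ℚ), ((-540 : ℤ) : ℚ), ((-11 : ℤ) : ℚ), ((53097 : ℤ) : ℚ), ((-852573 : ℤ) : ℚ)⟩ : WeierstrassCurve ℚ)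
    (⟨1, 2, 0, 11 / 2⟩ : VariableChange ℚ), mordellWeilRank_congr variableChange_model]

/-! ## §3 The door at `5` on the twist: rank `1`, `t₅ = 0` -/

/-- `ω(111) = 2` and `ω₂(111) = 1` (`111 = 3·37`, `37 ≡ 1 (mod 3)`). [folklore] -/
private theorem card_primeFactors :
    (((37 : ℤ) * 3).natAbs.primeFactors).card = 2 ∧ ((((37 : ℤ) * 3).natAbs.primeFactors.filter (fun ℓ ↦ ℓ % 3 = 1))).card = 1 := by
  have e : ((37 : ℤ) * 3).natAbs = 37 * 3 := by norm_num
  rw [e, Nat.primeFactors_mul (by norm_num) (by norm_num), Nat.Prime.primeFactors (by norm_num : Nat.Prime 37),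
    Nat.Prime.primeFactors Nat.prime_three]
  exact ⟨by decide, by decide⟩

/-- **`rank E_{37/3}^{(-3)}(ℚ) = 1`, `t₅(E_{37/3}^{(-3)}/ℚ) = 0`, `t₅(E_{37/3}/ℚ) = 0` — unconditionally, by the `5`-descent over `ℚ(ζ₃)`** (class-wide
`KubertTateEisensteinTwist.twist_door_of_le_rank_three`: Eisenstein-tame, full `ℚ`-box (`rank E(ℚ) = 1 = ω − 1`), and the twist's rank attains
`ω₂ = 1`; reference point `(-231/4, -3969/8)`, good prime `7`). [cite: SilvermanAEC2009, Thm. X.4.2 and Exercise 10.16] [cite: Fisher2001FiveSevenDescent, §2] -/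
theorem twist_37_3 :
    haveI := isElliptic_twist
    ((kubertTateFive (((37 : ℤ) : ℚ)) (((3 : ℤ) : ℚ))).quadraticTwist (-3)).mordellWeilRank = 1 ∧
      ((kubertTateFive (((37 : ℤ) : ℚ)) (((3 : ℤ) : ℚ))).quadraticTwist (-3)).shaCorank 5 = 0 ∧
      (kubertTateFive (((37 : ℤ) : ℚ)) (((3 : ℤ) : ℚ))).shaCorank 5 = 0 := by
  haveI := KubertTate373Descent.isElliptic
  haveI := isElliptic_twist
  haveI : Fact (Nat.Prime 7) := ⟨by norm_num⟩
  have hP : (kubertTateFive (((37 : ℤ) : ℚ)) (((3 : ℤ) : ℚ))).toAffine.Nonsingular (-231 / 4) (-3969 / 8) :=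
    (KubertTate373Descent.nonsingular_iff _ _).mpr (by norm_num)
  obtain ⟨hω, hω₂⟩ := card_primeFactors
  have hr : ((37 : ℤ) * 3).natAbs.primeFactors.card ≤ (kubertTateFive (((37 : ℤ) : ℚ)) (((3 : ℤ) : ℚ))).mordellWeilRank + 1 := by
    rw [hω, KubertTate373Descent.mordellWeilRank_eq]
  have hr' : (((37 : ℤ) * 3).natAbs.primeFactors.filter (fun ℓ ↦ ℓ % 3 = 1)).card ≤
      ((kubertTateFive (((37 : ℤ) : ℚ)) (((3 : ℤ) : ℚ))).quadraticTwist (-3)).mordellWeilRank := by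
    rw [hω₂, ← mordellWeilRank_model_eq_twist]; exact one_le_mordellWeilRank_model
  obtain ⟨ht, hE, hrk⟩ := KubertTateEisensteinTwist.twist_door_of_le_rank_three 37 3 KubertTateVelu.eisenstein_tame_37_3.1
    KubertTateVelu.eisenstein_tame_37_3.2 hP (by norm_num) (by norm_num) 7 (by norm_num) (by norm_num)
    KubertTate373Descent.not_tor_dvd_Δ hr hr'
  exact ⟨by rw [hrk, hω₂], ht, hE⟩

/-! ## §4 The Eisenstein prime `5` of the minimal model: `a₅ = −1`, good, reducible, non-anomalous; `corank Sel_{5^∞} = 1` -/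

/-- The reduction of the integer model modulo `5`: `y² + 4y = x³ + 2x + 2`. [folklore] -/
private theorem map_zmod_five :
    (⟨0, -540, -11, 53097, -852573⟩ : WeierstrassCurve ℤ).map (Int.castRingHom (ZMod 5)) =
      (⟨0, 0, 4, 2, 2⟩ : WeierstrassCurve (ZMod 5)) := by
  ext <;> simp [WeierstrassCurve.map] <;> decide

/-- **`#W̃(𝔽₅) = 7`** (`6` affine points and `O`). [cite: SilvermanAEC2009, V.2] -/
theorem natCard_point_five :
    Nat.card (((⟨0, -540, -11, 53097, -852573⟩ : WeierstrassCurve ℤ).map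
      (Int.castRingHom (ZMod 5))).toAffine.Point) = 7 := by
  rw [map_zmod_five, natCard_point_eq_one_add_card (F := ZMod 5) _ (by decide)]
  have h : Fintype.card {xy : ZMod 5 × ZMod 5 //
      xy.2 ^ 2 + (⟨0, 0, 4, 2, 2⟩ : WeierstrassCurve (ZMod 5)).a₁ * xy.1 * xy.2 +
        (⟨0, 0, 4, 2, 2⟩ : WeierstrassCurve (ZMod 5)).a₃ * xy.2 =
      xy.1 ^ 3 + (⟨0, 0, 4, 2, 2⟩ : WeierstrassCurve (ZMod 5)).a₂ * xy.1 ^ 2 +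
        (⟨0, 0, 4, 2, 2⟩ : WeierstrassCurve (ZMod 5)).a₄ * xy.1 + (⟨0, 0, 4, 2, 2⟩ : WeierstrassCurve (ZMod 5)).a₆} = 6 := by
    decide +kernel
  rw [h]

/-- The integer discriminant of the model. [folklore] -/
private theorem Δ_model : (⟨0, -540, -11, 53097, -852573⟩ : WeierstrassCurve ℤ).Δ = 1707486279144381 := by
  norm_num [WeierstrassCurve.Δ, WeierstrassCurve.b₂, WeierstrassCurve.b₄, WeierstrassCurve.b₆, WeierstrassCurve.b₈]

/-- **`a₅(W) = −1`** (`= 5 + 1 − 7`) and **`5` is a prime of good reduction of `W`** (`5 ∤ Δ_min`): the Eisenstein prime `5` of the twist is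
NON-anomalous and ordinary. [cite: SilvermanAEC2009, V.2 and VII.5 Prop. 5.1(a)] -/
theorem frobeniusTrace_five_model :
    haveI := isGloballyMinimal_model
    haveI : Fact (Nat.Prime 5) := ⟨Nat.prime_five⟩
    (⟨((0 : ℤ) : ℚ), ((-540 : ℤ) : ℚ), ((-11 : ℤ) : ℚ), ((53097 : ℤ) : ℚ), ((-852573 : ℤ) : ℚ)⟩ : WeierstrassCurve ℚ).frobeniusTrace 5 = -1 ∧
      (⟨((0 : ℤ) : ℚ), ((-540 : ℤ) : ℚ), ((-11 : ℤ) : ℚ), ((53097 : ℤ) : ℚ), ((-852573 : ℤ) : ℚ)⟩ : WeierstrassCurve ℚ).HasGoodReductionAtPrime 5 := by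
  haveI := isGloballyMinimal_model
  haveI : Fact (Nat.Prime 5) := ⟨Nat.prime_five⟩
  refine ⟨?_, hasGoodReductionAtPrime_of_not_dvd _ 5 ?_⟩
  · rw [WeierstrassCurve.frobeniusTrace, WeierstrassCurve.reductionPointCount, integralModelInt_model, natCard_point_five]
    norm_num
  · rw [minimalDiscriminantInt, integralModelInt_model, Δ_model]; norm_num

/-- **`E_{37/3}[5]` is reducible** (the rational `5`-torsion point `(0,0)` spans a `Γ_ℚ`-stable line). [cite: Mazur1977, Ch. III §5, p. 157] -/
theorem red_five :
    haveI : Fact (Nat.Prime 5) := ⟨Nat.prime_five⟩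
    ¬ (kubertTateFive (((37 : ℤ) : ℚ)) (((3 : ℤ) : ℚ))).HasIrreducibleModPGaloisRep 5 := by
  haveI := KubertTate373Descent.isElliptic
  haveI : Fact (Nat.Prime 5) := ⟨Nat.prime_five⟩
  obtain ⟨P, hP⟩ := exists_addOrderOf_eq_five_kubertTateFive (F := ℚ) (m := (((37 : ℤ) : ℚ))) (n := (((3 : ℤ) : ℚ)))
    (by norm_num) (by norm_num)
  exact not_hasIrreducibleModPGaloisRep_of_addOrderOf_eq _ hP

/-- **`W[5]` is reducible** (`W ≅ E_{37/3}^{(-3)}`, a quadratic twist of a curve with reducible `E[5]`). [cite: SilvermanAEC2009, X.5 Cor. 5.4] -/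
theorem red_five_model :
    haveI : Fact (Nat.Prime 5) := ⟨Nat.prime_five⟩
    ¬ (⟨((0 : ℤ) : ℚ), ((-540 : ℤ) : ℚ), ((-11 : ℤ) : ℚ), ((53097 : ℤ) : ℚ), ((-852573 : ℤ) : ℚ)⟩ :
      WeierstrassCurve ℚ).HasIrreducibleModPGaloisRep 5 := by
  haveI := KubertTate373Descent.isElliptic
  haveI := isElliptic_model
  haveI : Fact (Nat.Prime 5) := ⟨Nat.prime_five⟩
  exact not_hasIrreducibleModPGaloisRep_twist red_five (d := -3) (by norm_num) _ _ variableChange_model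

/-- **`(W, 5)` is a NON-anomalous Eisenstein pair of good reduction**: `Good W 5`, `Red W 5`, `¬ Anom W 5` (`a₅ = −1 ≢ 1 (mod 5)`).
[cite: CastellaGrossiLeeSkinner2022, Thm. E] -/
theorem good_red_not_anom_five_model :
    haveI := isGloballyMinimal_model
    haveI : Fact (Nat.Prime 5) := ⟨Nat.prime_five⟩
    Good (⟨((0 : ℤ) : ℚ), ((-540 : ℤ) : ℚ), ((-11 : ℤ) : ℚ), ((53097 : ℤ) : ℚ), ((-852573 : ℤ) : ℚ)⟩ : WeierstrassCurve ℚ) 5 ∧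
      Red (⟨((0 : ℤ) : ℚ), ((-540 : ℤ) : ℚ), ((-11 : ℤ) : ℚ), ((53097 : ℤ) : ℚ), ((-852573 : ℤ) : ℚ)⟩ : WeierstrassCurve ℚ) 5 ∧
      ¬ Anom (⟨((0 : ℤ) : ℚ), ((-540 : ℤ) : ℚ), ((-11 : ℤ) : ℚ), ((53097 : ℤ) : ℚ), ((-852573 : ℤ) : ℚ)⟩ : WeierstrassCurve ℚ) 5 := by
  haveI := isGloballyMinimal_model
  haveI : Fact (Nat.Prime 5) := ⟨Nat.prime_five⟩
  obtain ⟨ha, hgood⟩ := frobeniusTrace_five_model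
  refine ⟨hgood, red_five_model, fun hanom ↦ ?_⟩
  obtain ⟨-, -, hdvd⟩ := hanom
  rw [ha] at hdvd
  norm_num at hdvd

/-- **`rank W(ℚ) = 1`.** [cite: SilvermanAEC2009, VIII.§1 and Exercise 10.16] -/
theorem mordellWeilRank_model :
    haveI := isElliptic_model
    (⟨((0 : ℤ) : ℚ), ((-540 : ℤ) : ℚ), ((-11 : ℤ) : ℚ), ((53097 : ℤ) : ℚ), ((-852573 : ℤ) : ℚ)⟩ : WeierstrassCurve ℚ).mordellWeilRank = 1 := by
  haveI := isElliptic_model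
  haveI := isElliptic_twist
  rw [mordellWeilRank_model_eq_twist]
  exact twist_37_3.1

/-- **`corank_{ℤ₅} Sel_{5^∞}(W/ℚ) = 1`** — the hypothesis of CGLS Theorem E (`r = 1`) at the non-anomalous Eisenstein pair `(W, 5)`, certified by
descent alone: `corank Sel₅∞(W) = corank Sel₅∞(E_{37/3}^{(-3)})` (tree `selmerCorank_eq_of_variableChange`) `= rank + t₅ = 1 + 0` (Greenberg's
identity, tree `selmerCorank_eq_mordellWeilRank_add_holds`). [cite: CastellaGrossiLeeSkinner2022, Thm. E (r = 1)] [cite: SilvermanAEC2009, Thm. X.4.2] -/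
theorem selmerCorank_model_five :
    haveI := isElliptic_model
    haveI : Fact (Nat.Prime 5) := ⟨Nat.prime_five⟩
    (⟨((0 : ℤ) : ℚ), ((-540 : ℤ) : ℚ), ((-11 : ℤ) : ℚ), ((53097 : ℤ) : ℚ), ((-852573 : ℤ) : ℚ)⟩ : WeierstrassCurve ℚ).selmerCorank 5 = 1 := by
  haveI := isElliptic_model
  haveI := isElliptic_twist
  haveI : Fact (Nat.Prime 5) := ⟨Nat.prime_five⟩
  obtain ⟨hr, ht, -⟩ := twist_37_3
  rw [selmerCorank_eq_of_variableChange 5 variableChange_model,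
    ((kubertTateFive (((37 : ℤ) : ℚ)) (((3 : ℤ) : ℚ))).quadraticTwist (-3)).selmerCorank_eq_mordellWeilRank_add_holds 5, hr, ht]

end KubertTate373EisensteinTwist

end Literature.NumberTheory.EllipticCurves

end
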